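import Literature.InformationTheory.QuantumCodes.HypergraphProductGallagerFamily
import Literature.InformationTheory.QuantumCodes.CSSMixedChannelThreshold
import HarnessLib

/-!
# Losses AND errors for CSS code families: the certified region `(w-1)·(y + 2(1-y)√(p(1-p))) < 1`
# (type-family form), with the planar surface codes (`3Υ < 1`) and the positive-rate Gallager–Tillich–Zémor
# family (`11Υ < 1`) as instances

Topic `Literature/InformationTheory/QuantumCodes` (venture QEC, LADDER-QEC rung Q5; qec-lit-2 gen 3). PROVED, no
named fact, kernel axioms. `CSSMixedChannelThreshold.lean` proves Dumer–Kovalev–Pryadko's Theorem 2 in full for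
ONE code (losses of rate `y` with known locations + independent flips of rate `p`; decoders minimising the weight
OUTSIDE the erasure; `mixedFailureProb_le`) and its family form for `Fin`-indexed families. This file gives the
TYPE-FAMILY form (`mixedThreshold_of_rowWeight'`, qubit/check types varying with the index, as the hypergraph
product families need) and instantiates it: the planar surface codes (`planar_mixedThreshold`: region
`3·Υ_CSS(y,p) < 1`, interpolating the certified erasure threshold `1/3` and error threshold `p₀(3)`), and the
positive-rate family `HGP(G_j, G_jᵀ)` of `HypergraphProductGallagerFamily.lean` (`gallagerHGP_mixedThreshold`:
`11·Υ_CSS < 1`), each with the non-vacuity of the decoder class (`ErasureDecoder.minWeightOutside`).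

## References

* [DumerKovalevPryadko2015] I. Dumer, A. A. Kovalev, L. P. Pryadko, PRL 115 (2015) 050502, Thm 2, App. A §1.1.
* [StaceBarrettDoherty2009] T. M. Stace, S. D. Barrett, A. C. Doherty, PRL 102 (2009) 200501 (loss + error model).
* [TillichZemor2014] J.-P. Tillich, G. Zémor, IEEE Trans. IT 60 (2014) 1193, Thm 1.
-/

noncomputable section

namespace Literature.InformationTheory.QuantumCodes

open Finset Matrix Filter Topology

section TypeFamily

variable {Q C : ℕ → Type*} [∀ i, Fintype (Q i)] [∀ i, DecidableEq (Q i)]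

/-- **DKP15 Theorem 2, type-family form (losses AND errors).** A family of binary check matrices `H i` with
rows of weight `≤ w` (`w ≥ 2`), trivial spaces `SX i`, sector distances `≥ d i ≥ 1` with `|Q i| · r^{d i} → 0`
for every `0 < r < 1`; then for every family of minimum-weight-outside-the-erasure decoders and every `(y, p)`
with `0 ≤ y ≤ 1`, `0 ≤ p ≤ 1/2`, `(w-1)·Υ_CSS(y,p) < 1`: `Prob_fail → 0`.
[cite: DumerKovalevPryadko2015, Thm 2 (full statement, (w−1)Υ_CSS < 1)] -/
theorem mixedThreshold_of_rowWeight' (H : ∀ i, Matrix (C i) (Q i) (ZMod 2))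
    (SX : ∀ i, Submodule (ZMod 2) (Q i → ZMod 2)) (D : ∀ i, ErasureDecoder (Q i) (C i → ZMod 2))
    (hD : ∀ i, (D i).IsMinWeightOutside (H i))
    {w : ℕ} (hw : 2 ≤ w) (hrow : ∀ i j, (rowSupp (H i) j).card ≤ w) (d : ℕ → ℕ) (hd1 : ∀ i, 1 ≤ d i)
    (hd : ∀ i (x : Q i → ZMod 2), H i *ᵥ x = 0 → x ∉ SX i → d i ≤ hammingNorm x)
    (hgrowth : ∀ r : ℝ, 0 < r → r < 1 →
      Tendsto (fun i => (Fintype.card (Q i) : ℝ) * r ^ d i) atTop (𝓝 0))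
    {y p : ℝ} (hy0 : 0 ≤ y) (hy1 : y ≤ 1) (hp0 : 0 ≤ p) (hp : p ≤ 1 / 2)
    (hr : ((w - 1 : ℕ) : ℝ) * upsilonCSS y p < 1) :
    Tendsto (fun i => mixedFailureProb (H i) (SX i : Set (Q i → ZMod 2)) (D i) y p) atTop (𝓝 0) := by
  set K : ℝ := ((w - 1 : ℕ) : ℝ) with hK
  have hK1 : 1 ≤ K := by
    rw [hK]
    exact_mod_cast (show 1 ≤ w - 1 by omega)
  have hK0 : 0 < K := by linarith
  have hΥ0 : 0 ≤ upsilonCSS y p := by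
    unfold upsilonCSS
    have := Real.sqrt_nonneg (p * (1 - p))
    nlinarith
  set r : ℝ := K * upsilonCSS y p with hrdef
  have hr0 : 0 ≤ r := by positivity
  have hr1 : r < 1 := hr
  have h1r : 0 < 1 - r := by linarith
  have hp1 : p ≤ 1 := by linarith
  have hbound : ∀ i, mixedFailureProb (H i) (SX i : Set (Q i → ZMod 2)) (D i) y p ≤
      (Fintype.card (Q i) : ℝ) * r ^ d i / (K * (1 - r)) := fun i =>
    mixedFailureProb_le (H i) (SX i) (hD i) hw (hrow i) (hd1 i) (hd i) hy0 hy1 hp0 hp hr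
  have hnonneg : ∀ i, 0 ≤ mixedFailureProb (H i) (SX i : Set (Q i → ZMod 2)) (D i) y p := by
    intro i
    unfold mixedFailureProb
    exact Finset.sum_nonneg fun Er _ => mul_nonneg (bernoulliWeight_nonneg hy0 hy1 _)
      (Finset.sum_nonneg fun E _ => bernoulliWeight_nonneg hp0 hp1 _)
  have hQ : Tendsto (fun i => (Fintype.card (Q i) : ℝ) * r ^ d i / (K * (1 - r))) atTop (𝓝 0) := by
    rcases hr0.eq_or_lt with hr00 | hrpos
    · have : (fun i => (Fintype.card (Q i) : ℝ) * r ^ d i / (K * (1 - r))) = fun _ => 0 := by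
        funext i
        rw [← hr00, zero_pow (by have := hd1 i; omega)]
        simp
      rw [this]
      exact tendsto_const_nhds
    · have h := (hgrowth r hrpos hr1).div_const (K * (1 - r))
      simpa using h
  exact squeeze_zero hnonneg hbound hQ

end TypeFamily

/-! ### Instances -/

/-- Polynomial size times geometric decay tends to `0`. [cite: DennisEtAl2002, §5.3 (L² μ^L (4p̃)^{L/2} → 0)] -/
private theorem tendsto_poly_mul_pow'' {r : ℝ} (hr0 : 0 < r) (hr1 : r < 1) (A : ℝ) (m : ℕ) :
    Tendsto (fun k : ℕ => A * ((k : ℝ) + 2) ^ m * r ^ (k + 2)) atTop (𝓝 0) := by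
  have h0 := tendsto_pow_const_mul_const_pow_of_abs_lt_one m
    (show |r| < 1 by rwa [abs_of_nonneg hr0.le])
  have h1 : Tendsto (fun k : ℕ => ((k + 2 : ℕ) : ℝ) ^ m * r ^ (k + 2)) atTop (𝓝 0) :=
    (Filter.tendsto_add_atTop_iff_nat 2).2 h0
  have h2 := h1.const_mul A
  rw [mul_zero] at h2
  refine h2.congr fun k => ?_
  push_cast
  ring

/-- **Planar surface codes under losses and errors**: for every family of minimum-weight-outside-the-losses
decoders of the `H_X`-detected sector and every `(y, p)` with `3·(y + 2(1-y)√(p(1-p))) < 1`: `Prob_fail → 0`.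
UNCONDITIONAL. [cite: DumerKovalevPryadko2015, Thm 2 (w = 4)] -/
theorem planar_mixedThreshold (D : ∀ k, ErasureDecoder (PlanarQubit k) (PlanarCheck k → ZMod 2))
    (hD : ∀ k, (D k).IsMinWeightOutside (planarHX k))
    {y p : ℝ} (hy0 : 0 ≤ y) (hy1 : y ≤ 1) (hp0 : 0 ≤ p) (hp : p ≤ 1 / 2) (hr : 3 * upsilonCSS y p < 1) :
    Tendsto (fun k => mixedFailureProb (planarHX k) (planarSZ k : Set (PlanarQubit k → ZMod 2)) (D k) y p)
      atTop (𝓝 0) := by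
  refine mixedThreshold_of_rowWeight' planarHX planarSZ D hD (w := 4) (by norm_num) card_rowSupp_planarHX_le
    (fun k => k + 2) (fun k => by omega) le_hammingNorm_of_planar_cycle ?_ hy0 hy1 hp0 hp
    (by norm_num; linarith)
  intro r hr0 hr1
  have hl := tendsto_poly_mul_pow'' hr0 hr1 2 2
  refine squeeze_zero (fun k => by positivity) (fun k => ?_) hl
  rw [card_planarQubit]
  have hk : (0 : ℝ) ≤ k := Nat.cast_nonneg k
  have hrk : 0 ≤ r ^ (k + 2) := pow_nonneg hr0.le _
  push_cast
  nlinarith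

/-- Non-vacuity of the decoder class (planar). [cite: DumerKovalevPryadko2015, p. 3 (exhaustive search decoder)] -/
theorem planar_minWeightOutside_isMinWeightOutside (k : ℕ) :
    (ErasureDecoder.minWeightOutside (planarHX k)).IsMinWeightOutside (planarHX k) :=
  ErasureDecoder.minWeightOutside_isMinWeightOutside (planarHX k)

/-- **The positive-rate Gallager–Tillich–Zémor family under losses and errors**: region
`11·(y + 2(1-y)√(p(1-p))) < 1` for every family of minimum-weight-outside-the-losses decoders. UNCONDITIONAL.
[cite: DumerKovalevPryadko2015, Thm 2 (w = 12)] -/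
theorem gallagerHGP_mixedThreshold (D : ∀ j, ErasureDecoder (GallagerQubit j) (GallagerCheck j → ZMod 2))
    (hD : ∀ j, (D j).IsMinWeightOutside (gallagerHX j))
    {y p : ℝ} (hy0 : 0 ≤ y) (hy1 : y ≤ 1) (hp0 : 0 ≤ p) (hp : p ≤ 1 / 2) (hr : 11 * upsilonCSS y p < 1) :
    Tendsto (fun j => mixedFailureProb (gallagerHX j) (gallagerSZ j : Set (GallagerQubit j → ZMod 2)) (D j) y p)
      atTop (𝓝 0) := by
  refine mixedThreshold_of_rowWeight' gallagerHX gallagerSZ D hD (w := 12) (by norm_num)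
    card_rowSupp_gallagerHX_le (fun j => j + 2) (fun j => by omega) le_hammingNorm_of_gallager_cycle ?_
    hy0 hy1 hp0 hp (by norm_num; linarith)
  intro r hr0 hr1
  have hl := tendsto_poly_mul_pow'' hr0 hr1 (8 * 650 ^ 2) 2
  refine squeeze_zero (fun j => by positivity) (fun j => ?_) hl
  exact mul_le_mul_of_nonneg_right (card_gallagerQubit_le_real j) (pow_nonneg hr0.le _)

/-- Non-vacuity of the decoder class (Gallager–TZ family). [cite: DumerKovalevPryadko2015, p. 3 (exhaustive search decoder)] -/
theorem gallager_minWeightOutside_isMinWeightOutside (j : ℕ) :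
    (ErasureDecoder.minWeightOutside (gallagerHX j)).IsMinWeightOutside (gallagerHX j) :=
  ErasureDecoder.minWeightOutside_isMinWeightOutside (gallagerHX j)

end Literature.InformationTheory.QuantumCodes
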